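import Mathlib
import Summits.Ventures.PercRepro2.MeasureBridgeProb
import Summits.Ventures.PercRepro2.HCovFns

/-!
# (HCOV) as a covariance inequality for Mathlib's product Bernoulli measure
(blind cell PercRepro2, typer-1 g15, 2026-08-26)

The cleared form `Gc` of the covariance statement (HCOV) (`HCov.lean`: `HCov := 0 ≤ Gc`,
`Gc = D · P(Q) · G` with `G = P(Q) Cov_Q(σ_b, F) − D Cov_PD(1_{b∈U}, 1_{o∈U})`) is here written
with Mathlib's conditional measure `μ[|A]` (`ProbabilityTheory.cond`) and covariance
`cov[X, Y; μ]` (`ProbabilityTheory.covariance`) for `μ = percMeasureOf p hp`, the product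
Bernoulli measure of the admissible weights `p` (`MeasureBridgeProb.lean`):

* `Gc_eq_covariance` : `Gc = D · P(Q)² · cov[σ_b, F; μ[|Q]] − P(Q) · D² · cov[1_{b∈U}, 1_{o∈U}; μ[|PD]]`
  (unconditionally — both sides vanish when `P(Q) = 0` or `D = 0`), where `σ_v = 1_{v∈C₁} − 1_{v∈C₂}`
  (`sigma`), `1_{v∈U} = 1_{v∈C₁} + 1_{v∈C₂}` (`inU`), `F = σ_o + σ₃ (γ − 1_{o∈U})` (`Ffun`) and
  `γ = D_o / D` (`gamma`), exactly the functions of `HCovFns.lean`;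
* `HCov_iff_covariance` : for `0 < P(Q)` and `0 < D`,
  `HCov ↔ D · cov[1_{b∈U}, 1_{o∈U}; μ[|PD]] ≤ P(Q) · cov[σ_b, F; μ[|Q]]` —
  **the conjecture of record in the language of conditional covariances**: conditioned on the roots
  being disconnected, the side sign of `b` and the signed functional `F` of `o` and `a₃` are
  positively correlated, up to the `PD`-correction.

Tools: `integral_cond_percMeasureOf` (integrals against `μ[|A]` as finite sums),
`covariance_cond_percMeasureOf` (covariance under `μ[|A]` as finite sums), the twelve expectation
lemmas `expect_f1 … expect_f12` of `HCovFns.lean`.  Own work; standard axioms.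
-/

namespace Summit.Ventures.PercRepro2

open MeasureTheory ProbabilityTheory MeasureBridge

namespace CovForm

section Cond

variable {E : Type*} [Fintype E] [DecidableEq E]

/-- Three-term linearity of `expect`. -/
lemma expect_lin3 (p : E → ℝ) (a b d : Config E → ℝ) (c : ℝ) :
    expect p (fun ω => a ω + c * b ω - d ω) = expect p a + c * expect p b - expect p d := by
  unfold expect
  rw [Finset.mul_sum, ← Finset.sum_add_distrib, ← Finset.sum_sub_distrib]
  exact Finset.sum_congr rfl fun ω _ => by ring

/-- The integral against the product measure conditioned on `A` is a finite sum:
`∫ g ∂μ[|A] = P(A)⁻¹ · E_p[1_A g]`. -/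
lemma integral_cond_percMeasureOf (p : E → ℝ) (hp : IsProbVec p) (A : Set (Config E))
    (g : Config E → ℝ) :
    ∫ ω, g ω ∂((percMeasureOf p hp)[|A]) =
      (prob p A)⁻¹ * expect p (fun ω => A.indicator 1 ω * g ω) := by
  rw [ProbabilityTheory.cond, integral_smul_measure, ENNReal.toReal_inv, ← measureReal_def,
    percMeasureOf_real_apply, ← integral_indicator MeasurableSet.of_discrete, integral_percMeasureOf,
    smul_eq_mul]
  congr 1
  unfold expect
  refine Finset.sum_congr rfl fun ω _ => ?_
  by_cases h : ω ∈ A <;> simp [h]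

/-- `μ[|A]` is the zero measure when `P(A) = 0`. -/
lemma cond_percMeasureOf_eq_zero (p : E → ℝ) (hp : IsProbVec p) {A : Set (Config E)}
    (hA : prob p A = 0) : (percMeasureOf p hp)[|A] = 0 := by
  apply cond_eq_zero_of_meas_eq_zero
  rw [← measureReal_eq_zero_iff, percMeasureOf_real_apply]
  exact hA

/-- `μ[|A]` is a probability measure when `P(A) ≠ 0`. -/
lemma cond_percMeasureOf_isProbabilityMeasure (p : E → ℝ) (hp : IsProbVec p)
    {A : Set (Config E)} (hA : prob p A ≠ 0) : IsProbabilityMeasure ((percMeasureOf p hp)[|A]) := by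
  apply cond_isProbabilityMeasure
  rw [← measureReal_ne_zero_iff, percMeasureOf_real_apply]
  exact hA

/-- **Covariance under the conditioned product measure as finite sums**:
`cov[X, Y; μ[|A]] = P(A)⁻¹ E[1_A X Y] − P(A)⁻² E[1_A X] E[1_A Y]` when `P(A) ≠ 0`. -/
lemma covariance_cond_percMeasureOf (p : E → ℝ) (hp : IsProbVec p) {A : Set (Config E)}
    (hA : prob p A ≠ 0) (X Y : Config E → ℝ) :
    cov[X, Y; (percMeasureOf p hp)[|A]] =
      (prob p A)⁻¹ * expect p (fun ω => A.indicator 1 ω * (X ω * Y ω)) -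
        ((prob p A)⁻¹ * expect p (fun ω => A.indicator 1 ω * X ω)) *
          ((prob p A)⁻¹ * expect p (fun ω => A.indicator 1 ω * Y ω)) := by
  haveI := cond_percMeasureOf_isProbabilityMeasure p hp hA
  rw [covariance_eq_sub MemLp.of_discrete MemLp.of_discrete, integral_cond_percMeasureOf,
    integral_cond_percMeasureOf, integral_cond_percMeasureOf]
  rfl

/-- The covariance under `μ[|A]` vanishes when `P(A) = 0`. -/
lemma covariance_cond_percMeasureOf_of_eq_zero (p : E → ℝ) (hp : IsProbVec p)
    {A : Set (Config E)} (hA : prob p A = 0) (X Y : Config E → ℝ) :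
    cov[X, Y; (percMeasureOf p hp)[|A]] = 0 := by
  rw [cond_percMeasureOf_eq_zero p hp hA, covariance_zero_measure]

end Cond

section Covariance

variable {V : Type*} {E : Type*} [Fintype E] [DecidableEq E] [DecidableEq V]

/-- `γ = D_o / D` (the conditional probability `P(o ∈ U | PD)`; `0` when `D = 0`). -/
noncomputable def gamma (p : E → ℝ) (ends : E → Sym2 V) (o a₁ a₂ a₃ : V) : ℝ :=
  Do p ends o a₁ a₂ a₃ / prob p (PDEvent ends a₁ a₂ a₃)

omit [Fintype E] [DecidableEq E] [DecidableEq V] in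
/-- The signed functional `F = σ_o + σ₃ (γ − 1_{o∈U})` of the (HCOV) covariance form. -/
noncomputable def Ffun (ends : E → Sym2 V) (o a₁ a₂ a₃ : V) (γ : ℝ) : Config E → ℝ :=
  fun ω => sigma ends a₁ a₂ o ω + sigma ends a₁ a₂ a₃ ω * (γ - inU ends a₁ a₂ o ω)

omit [DecidableEq V] in
/-- `E_p[1_Q σ_b F] = EQbo + γ EQb3 − EQb3o`. -/
lemma expect_Q_sigma_F (p : E → ℝ) (ends : E → Sym2 V) (o a₁ a₂ a₃ b : V) (γ : ℝ) :
    expect p (fun ω => (avoidAll ends a₂ {a₁}).indicator 1 ω *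
        (sigma ends a₁ a₂ b ω * Ffun ends o a₁ a₂ a₃ γ ω)) =
      EQbo p ends o a₁ a₂ b + γ * EQb3 p ends a₁ a₂ a₃ b - EQb3o p ends o a₁ a₂ a₃ b := by
  have h : (fun ω => (avoidAll ends a₂ {a₁}).indicator (1 : Config E → ℝ) ω *
      (sigma ends a₁ a₂ b ω * Ffun ends o a₁ a₂ a₃ γ ω)) =
      fun ω => f4 ends o a₁ a₂ b ω + γ * f5 ends a₁ a₂ a₃ b ω - f6 ends o a₁ a₂ a₃ b ω := by
    funext ω
    simp only [f4, f5, f6, Ffun, iQ]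
    ring
  rw [h, expect_lin3, expect_f4, expect_f5, expect_f6]

omit [DecidableEq V] in
/-- `E_p[1_Q σ_b] = −gap`. -/
lemma expect_Q_sigma (p : E → ℝ) (ends : E → Sym2 V) (a₁ a₂ b : V) :
    expect p (fun ω => (avoidAll ends a₂ {a₁}).indicator 1 ω * sigma ends a₁ a₂ b ω) =
      -gap p ends a₁ a₂ b :=
  expect_f7 p ends a₁ a₂ b

omit [DecidableEq V] in
/-- `E_p[1_Q F] = EQo + γ EQ3 − EQ3o`. -/
lemma expect_Q_F (p : E → ℝ) (ends : E → Sym2 V) (o a₁ a₂ a₃ : V) (γ : ℝ) :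
    expect p (fun ω => (avoidAll ends a₂ {a₁}).indicator 1 ω * Ffun ends o a₁ a₂ a₃ γ ω) =
      EQo p ends o a₁ a₂ + γ * EQ3 p ends a₁ a₂ a₃ - EQ3o p ends o a₁ a₂ a₃ := by
  have h : (fun ω => (avoidAll ends a₂ {a₁}).indicator (1 : Config E → ℝ) ω *
      Ffun ends o a₁ a₂ a₃ γ ω) =
      fun ω => f7 ends a₁ a₂ o ω + γ * f7 ends a₁ a₂ a₃ ω - f10 ends o a₁ a₂ a₃ ω := by
    funext ω
    simp only [f7, f10, Ffun, iQ]
    ring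
  rw [h, expect_lin3, expect_f8, expect_f9, expect_f10]

omit [DecidableEq V] in
/-- `E_p[1_PD 1_{b∈U} 1_{o∈U}] = PDbo`. -/
lemma expect_PD_inU_inU (p : E → ℝ) (ends : E → Sym2 V) (o a₁ a₂ a₃ b : V) :
    expect p (fun ω => (PDEvent ends a₁ a₂ a₃).indicator 1 ω *
        (inU ends a₁ a₂ b ω * inU ends a₁ a₂ o ω)) = PDbo p ends o a₁ a₂ a₃ b := by
  rw [← expect_f11]
  congr 1
  funext ω
  simp only [f11, iPD]
  ring

omit [DecidableEq V] in
/-- `E_p[1_PD 1_{b∈U}] = PDb`. -/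
lemma expect_PD_inU_b (p : E → ℝ) (ends : E → Sym2 V) (a₁ a₂ a₃ b : V) :
    expect p (fun ω => (PDEvent ends a₁ a₂ a₃).indicator 1 ω * inU ends a₁ a₂ b ω) =
      PDb p ends a₁ a₂ a₃ b :=
  expect_f12 p ends a₁ a₂ a₃ b

omit [DecidableEq V] in
/-- `E_p[1_PD 1_{o∈U}] = D_o`. -/
lemma expect_PD_inU_o (p : E → ℝ) (ends : E → Sym2 V) (o a₁ a₂ a₃ : V) :
    expect p (fun ω => (PDEvent ends a₁ a₂ a₃).indicator 1 ω * inU ends a₁ a₂ o ω) =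
      Do p ends o a₁ a₂ a₃ :=
  expect_f3 p ends o a₁ a₂ a₃

omit [DecidableEq V] in
/-- When `D = 0`, every `PD`-mass vanishes: `D_o = 0`. -/
lemma Do_eq_zero_of_D_eq_zero {p : E → ℝ} (hp : IsProbVec p) (ends : E → Sym2 V) (o a₁ a₂ a₃ : V)
    (hD : prob p (PDEvent ends a₁ a₂ a₃) = 0) : Do p ends o a₁ a₂ a₃ = 0 := by
  unfold Do
  have h1 := prob_mono hp (Set.inter_subset_left (s := PDEvent ends a₁ a₂ a₃)
    (t := connEvent ends a₁ o))
  have h2 := prob_mono hp (Set.inter_subset_left (s := PDEvent ends a₁ a₂ a₃)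
    (t := connEvent ends a₂ o))
  have h3 := prob_nonneg hp (PDEvent ends a₁ a₂ a₃ ∩ connEvent ends a₁ o)
  have h4 := prob_nonneg hp (PDEvent ends a₁ a₂ a₃ ∩ connEvent ends a₂ o)
  rw [hD] at h1 h2
  linarith

omit [DecidableEq V] in
/-- When `D = 0`: `PDb = 0`. -/
lemma PDb_eq_zero_of_D_eq_zero {p : E → ℝ} (hp : IsProbVec p) (ends : E → Sym2 V) (a₁ a₂ a₃ b : V)
    (hD : prob p (PDEvent ends a₁ a₂ a₃) = 0) : PDb p ends a₁ a₂ a₃ b = 0 := by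
  unfold PDb
  have h1 := prob_mono hp (Set.inter_subset_left (s := PDEvent ends a₁ a₂ a₃)
    (t := connEvent ends a₁ b))
  have h2 := prob_mono hp (Set.inter_subset_left (s := PDEvent ends a₁ a₂ a₃)
    (t := connEvent ends a₂ b))
  have h3 := prob_nonneg hp (PDEvent ends a₁ a₂ a₃ ∩ connEvent ends a₁ b)
  have h4 := prob_nonneg hp (PDEvent ends a₁ a₂ a₃ ∩ connEvent ends a₂ b)
  rw [hD] at h1 h2
  linarith

omit [DecidableEq V] in
/-- When `D = 0`: `PDbo = 0`. -/
lemma PDbo_eq_zero_of_D_eq_zero {p : E → ℝ} (hp : IsProbVec p) (ends : E → Sym2 V)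
    (o a₁ a₂ a₃ b : V) (hD : prob p (PDEvent ends a₁ a₂ a₃) = 0) :
    PDbo p ends o a₁ a₂ a₃ b = 0 := by
  unfold PDbo
  have h1 := prob_mono hp (Set.inter_subset_left (s := PDEvent ends a₁ a₂ a₃)
    (t := connEvent ends a₁ o ∩ connEvent ends a₁ b))
  have h2 := prob_mono hp (Set.inter_subset_left (s := PDEvent ends a₁ a₂ a₃)
    (t := connEvent ends a₂ o ∩ connEvent ends a₁ b))
  have h3 := prob_mono hp (Set.inter_subset_left (s := PDEvent ends a₁ a₂ a₃)
    (t := connEvent ends a₁ o ∩ connEvent ends a₂ b))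
  have h4 := prob_mono hp (Set.inter_subset_left (s := PDEvent ends a₁ a₂ a₃)
    (t := connEvent ends a₂ o ∩ connEvent ends a₂ b))
  have h5 := prob_nonneg hp (PDEvent ends a₁ a₂ a₃ ∩ (connEvent ends a₁ o ∩ connEvent ends a₁ b))
  have h6 := prob_nonneg hp (PDEvent ends a₁ a₂ a₃ ∩ (connEvent ends a₂ o ∩ connEvent ends a₁ b))
  have h7 := prob_nonneg hp (PDEvent ends a₁ a₂ a₃ ∩ (connEvent ends a₁ o ∩ connEvent ends a₂ b))
  have h8 := prob_nonneg hp (PDEvent ends a₁ a₂ a₃ ∩ (connEvent ends a₂ o ∩ connEvent ends a₂ b))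
  rw [hD] at h1 h2 h3 h4
  linarith

omit [DecidableEq V] in
/-- `PD ⊆ Q`: `P(PD) ≤ P(Q)`. -/
lemma D_le_PQ {p : E → ℝ} (hp : IsProbVec p) (ends : E → Sym2 V) (a₁ a₂ a₃ : V) :
    prob p (PDEvent ends a₁ a₂ a₃) ≤ prob p (avoidAll ends a₂ {a₁}) := by
  apply prob_mono hp
  intro ω hω
  simp only [avoidAll, Set.mem_setOf_eq, Finset.mem_singleton, forall_eq]
  intro h
  exact hω.1 (conn_symm h)

omit [DecidableEq V] in
/-- **`Gc` as a difference of conditional covariances** (the identity `Gc = D · P(Q) · G`,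
ADDENDUM 19 (2), with Mathlib's `cond` and `covariance`):
`Gc = D · P(Q)² · cov[σ_b, F; μ[|Q]] − P(Q) · D² · cov[1_{b∈U}, 1_{o∈U}; μ[|PD]]`. -/
theorem Gc_eq_covariance (p : E → ℝ) (hp : IsProbVec p) (ends : E → Sym2 V) (o a₁ a₂ a₃ b : V) :
    Gc p ends o a₁ a₂ a₃ b =
      prob p (PDEvent ends a₁ a₂ a₃) * prob p (avoidAll ends a₂ {a₁}) ^ 2 *
          cov[sigma ends a₁ a₂ b, Ffun ends o a₁ a₂ a₃ (gamma p ends o a₁ a₂ a₃);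
            (percMeasureOf p hp)[|avoidAll ends a₂ {a₁}]] -
        prob p (avoidAll ends a₂ {a₁}) * prob p (PDEvent ends a₁ a₂ a₃) ^ 2 *
          cov[inU ends a₁ a₂ b, inU ends a₁ a₂ o; (percMeasureOf p hp)[|PDEvent ends a₁ a₂ a₃]] := by
  set PQ := prob p (avoidAll ends a₂ {a₁}) with hPQ
  set D := prob p (PDEvent ends a₁ a₂ a₃) with hD
  by_cases hD0 : D = 0
  · -- every `PD`-mass vanishes, and so does `Gc`
    have hDo := Do_eq_zero_of_D_eq_zero hp ends o a₁ a₂ a₃ hD0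
    have hPDb := PDb_eq_zero_of_D_eq_zero hp ends a₁ a₂ a₃ b hD0
    have hPDbo := PDbo_eq_zero_of_D_eq_zero hp ends o a₁ a₂ a₃ b hD0
    rw [covariance_cond_percMeasureOf_of_eq_zero p hp hD0]
    unfold Gc DEF
    rw [← hD, ← hPQ, hD0, hDo, hPDb, hPDbo]
    ring
  · have hPQ0 : PQ ≠ 0 := by
      intro h
      apply hD0
      have h1 := D_le_PQ hp ends a₁ a₂ a₃
      have h2 := prob_nonneg hp (PDEvent ends a₁ a₂ a₃)
      rw [← hD, ← hPQ] at h1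
      rw [← hD] at h2
      linarith
    rw [covariance_cond_percMeasureOf p hp hPQ0, covariance_cond_percMeasureOf p hp hD0,
      expect_Q_sigma_F, expect_Q_sigma, expect_Q_F, expect_PD_inU_inU, expect_PD_inU_b,
      expect_PD_inU_o]
    unfold Gc DEF gamma
    rw [← hD, ← hPQ]
    field_simp
    ring

omit [DecidableEq V] in
/-- **(HCOV) in the language of conditional covariances**: for `0 < P(Q)` and `0 < D`,
`HCov ↔ D · cov[1_{b∈U}, 1_{o∈U}; μ[|PD]] ≤ P(Q) · cov[σ_b, F; μ[|Q]]`. -/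
theorem HCov_iff_covariance (p : E → ℝ) (hp : IsProbVec p) (ends : E → Sym2 V) (o a₁ a₂ a₃ b : V)
    (hQ : 0 < prob p (avoidAll ends a₂ {a₁})) (hD : 0 < prob p (PDEvent ends a₁ a₂ a₃)) :
    HCov p ends o a₁ a₂ a₃ b ↔
      prob p (PDEvent ends a₁ a₂ a₃) *
          cov[inU ends a₁ a₂ b, inU ends a₁ a₂ o; (percMeasureOf p hp)[|PDEvent ends a₁ a₂ a₃]] ≤
        prob p (avoidAll ends a₂ {a₁}) *
          cov[sigma ends a₁ a₂ b, Ffun ends o a₁ a₂ a₃ (gamma p ends o a₁ a₂ a₃);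
            (percMeasureOf p hp)[|avoidAll ends a₂ {a₁}]] := by
  unfold HCov
  rw [Gc_eq_covariance p hp]
  set PQ := prob p (avoidAll ends a₂ {a₁})
  set D := prob p (PDEvent ends a₁ a₂ a₃)
  set cQ := cov[sigma ends a₁ a₂ b, Ffun ends o a₁ a₂ a₃ (gamma p ends o a₁ a₂ a₃);
    (percMeasureOf p hp)[|avoidAll ends a₂ {a₁}]]
  set cPD := cov[inU ends a₁ a₂ b, inU ends a₁ a₂ o; (percMeasureOf p hp)[|PDEvent ends a₁ a₂ a₃]]
  have hpos : 0 < D * PQ := mul_pos hD hQ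
  have hfac : D * PQ ^ 2 * cQ - PQ * D ^ 2 * cPD = (D * PQ) * (PQ * cQ - D * cPD) := by ring
  rw [hfac]
  constructor
  · intro h
    have := nonneg_of_mul_nonneg_right h hpos
    linarith
  · intro h
    exact mul_nonneg hpos.le (by linarith)

end Covariance

end CovForm

end Summit.Ventures.PercRepro2
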